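import Summits.ValiantsHypothesis.ValiantsHypothesis.Theorems.LacunarySymmetroidMatrixDescartesPivotRankOneFourKillSeven

/-!
# `MatrixDescartes` census — rank-one `(2,4)₁`, ONE below / THREE above: the two S-type kill-seven sets (S₀₁₂), (S₀₁₃) of chamber (C)
# (kept `{d₀+d₁, d₀+d₂, e+d₁, e+d₂}` and `{d₀+d₁, e+d₁, d₀+d₃, e+d₃}`; the sets the located census named after (T₀₃),(T₀₁),(T₁₂),(T₁₃) and the circuits)

HONEST FRAMING.  Object-search cell `pub-symmetroid`, seat `val-sym-mdr-p1` (generation 14); helper file `--supports` the crux item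
stmt-ValiantsHypothesis-18050 (`Theses.LacunarySymmetroid.MatrixDescartes`, OPEN, on HOLD) with NO closure claim.  Companions: `…PivotRankOneOneThreeKillSeven`
((T₀₃),(T₀₁),(T₁₂)), `…KillSevenFar` ((T₁₃)), `…OneThreeKillEight` (circuits) — together those cover ≈ 99.9 % of the seat's adversarial chamber-(C) samples
(exponents × directions × weights); the remainder was carried by the two S-type sets below (and one doubly-degenerate sample had no certificate at all —
located coverage of (C) is NOT closed, nothing is claimed).  Engine: `card_posRoots_le_kills` + `card_posRoots_fourNomial_le_one` (`…PivotTwoDirectionsBlockLaw`).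

* **(S₀₁₂)** kept `{d₀+d₁, d₀+d₂, e+d₁, e+d₂} = {d₀, e} + {d₁, d₂}` (steps `d₂−d₁`, `e−d₀`): killed four-nomial `A X^{d₀+d₁} − B X^{d₀+d₂} + C X^{e+d₁} − D X^{e+d₂}`,
  `B = w₀w₂Δ₀₂²·Π_B`, `D = w₂|m₂|·Π_D`; condition **`Δ₀₂²·|m₁|·Π_BΠ_C ≤ Δ₀₁²·|m₂|·Π_AΠ_D`** (in `t`-coordinates `σ₀₂·Π_BΠ_C ≤ σ₀₁·Π_AΠ_D`: letter `0` closer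
  in angle to `2` than to `1`, up to the exponent constant); `J`, `m₀, m₁, m₃` arbitrary, `m₂ < 0`, `Δ₀₂ ≠ 0`, `w₀,w₁,w₂ > 0`; exponent hypotheses
  `2e < d₀+d₂`, `d₀+d₃ < e+d₂` (`elevenNomial_oneThree_S012_le_eight`, `oneThree_rankOne_posRoots_le_eight_of_S012`).
* **(S₀₁₃)** kept `{d₀+d₁, e+d₁, d₀+d₃, e+d₃} = {d₀, e} + {d₁, d₃}` (steps `e−d₀`, `d₃−d₁`): condition **`|m₁|·Δ₀₃²·Π_BΠ_C ≤ |m₃|·Δ₀₁²·Π_AΠ_D`**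
  (`σ₀₃/σ₀₁ ≤ Π_AΠ_D/(Π_BΠ_C)`; the one/three analogue of g12's (S)); `J` arbitrary, `m₁, m₃ < 0`, `w₀,w₁,w₃ > 0`; hypotheses `d₀+d₂ < e+d₁`, `d₁+d₂ < e+d₃`
  (`elevenNomial_oneThree_S013_le_eight`, `oneThree_rankOne_posRoots_le_eight_of_S013`).

Nothing here bears on `MatrixDescartes` in its window, on `DoorA26` / `DoorA34`, registers / credences, or `VP ≠ VNP`.

[folklore] The engine of `…PivotTwoDirectionsBlockLaw`; `2 × 2` determinant algebra.  No definitions, no named facts.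
-/

-- `Summit.ValiantsHypothesis.ValiantsHypothesis.…` repeats a component by the D-0017 layout
-- (single-conjunct summit), which the `dupNamespace` linter flags; the name is mandated.
set_option linter.dupNamespace false

namespace Summit.ValiantsHypothesis.ValiantsHypothesis.Theorems.LacunarySymmetroidMatrixDescartes.Pivot.TwoDirections.BlockLaw

open Polynomial Matrix Finset
open scoped BigOperators

/-! ## 1. (S₀₁₂) -/

/-- **(S₀₁₂), real-parameter form** (split `d₀ < e < d₁ < d₂ < d₃`, `2e < d₀+d₂`, `d₀+d₃ < e+d₂`; `m₂ < 0`, `D02 > 0`, `w₀,w₁,w₂ > 0`, the rest arbitrary). -/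
theorem elevenNomial_oneThree_S012_le_eight (e d₀ d₁ d₂ d₃ : ℕ) (h0e : d₀ < e) (he1 : e < d₁) (h12 : d₁ < d₂) (h23 : d₂ < d₃)
    (hC2 : 2 * e < d₀ + d₂) (hC5 : d₀ + d₃ < e + d₂)
    (dJ m₀ m₁ m₂ m₃ w₀ w₁ w₂ w₃ D01 D02 D03 D12 D13 D23 : ℝ) (hw₀ : 0 < w₀) (hw₁ : 0 < w₁) (hw₂ : 0 < w₂) (hm₂ : m₂ < 0) (hD02 : 0 < D02)
    (hS : D02 * (-m₁)
        * (((d₀ : ℝ) + d₂ - 2 * e) * ((d₂ : ℝ) - e) * ((e : ℝ) + d₃ - d₀ - d₂) * ((d₃ : ℝ) - d₂) * ((d₁ : ℝ) - d₀) * ((d₁ : ℝ) + d₃ - d₀ - d₂) * ((d₃ : ℝ) - d₀))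
        * (((d₁ : ℝ) - e) * ((d₁ : ℝ) - d₀) * ((d₃ : ℝ) - d₁) * ((d₀ : ℝ) + d₃ - e - d₁) * ((d₂ : ℝ) - e) * ((d₃ : ℝ) - e) * ((d₂ : ℝ) + d₃ - e - d₁))
        ≤ D01 * (-m₂)
        * (((2 : ℝ) * e - d₀ - d₁) * ((d₁ : ℝ) - e) * ((e : ℝ) + d₃ - d₀ - d₁) * ((d₃ : ℝ) - d₁) * ((d₂ : ℝ) - d₀) * ((d₃ : ℝ) - d₀) * ((d₂ : ℝ) + d₃ - d₀ - d₁))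
        * (((d₂ : ℝ) - e) * ((d₂ : ℝ) - d₀) * ((d₃ : ℝ) - d₂) * ((e : ℝ) + d₂ - d₀ - d₃) * ((d₁ : ℝ) - e) * ((d₁ : ℝ) + d₃ - e - d₂) * ((d₃ : ℝ) - e))) :
    ((∑ i : Fin 11, Polynomial.C ((![dJ, w₀ * m₀, w₁ * m₁, w₂ * m₂, w₃ * m₃, w₀ * w₁ * D01, w₀ * w₂ * D02, w₀ * w₃ * D03, w₁ * w₂ * D12, w₁ * w₃ * D13, w₂ * w₃ * D23] : Fin 11 → ℝ) i) * X ^ ((![2 * e, e + d₀, e + d₁, e + d₂, e + d₃, d₀ + d₁, d₀ + d₂, d₀ + d₃, d₁ + d₂, d₁ + d₃, d₂ + d₃] : Fin 11 → ℕ) i)).roots.toFinset.filter (fun t => 0 < t)).card ≤ 8 := by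
  classical
  have h0e' : (d₀ : ℝ) < e := by exact_mod_cast h0e
  have he1' : (e : ℝ) < d₁ := by exact_mod_cast he1
  have h12' : (d₁ : ℝ) < d₂ := by exact_mod_cast h12
  have h23' : (d₂ : ℝ) < d₃ := by exact_mod_cast h23
  have hC2' : 2 * (e : ℝ) < d₀ + d₂ := by exact_mod_cast hC2
  have hC5' : (d₀ : ℝ) + d₃ < e + d₂ := by exact_mod_cast hC5
  -- the four distance products (positive atoms)
  obtain ⟨PA, hPA⟩ : ∃ x : ℝ, x = ((2 : ℝ) * e - d₀ - d₁) * ((d₁ : ℝ) - e) * ((e : ℝ) + d₃ - d₀ - d₁) * ((d₃ : ℝ) - d₁) * ((d₂ : ℝ) - d₀) * ((d₃ : ℝ) - d₀) * ((d₂ : ℝ) + d₃ - d₀ - d₁) := ⟨_, rfl⟩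
  obtain ⟨PB, hPB⟩ : ∃ x : ℝ, x = ((d₀ : ℝ) + d₂ - 2 * e) * ((d₂ : ℝ) - e) * ((e : ℝ) + d₃ - d₀ - d₂) * ((d₃ : ℝ) - d₂) * ((d₁ : ℝ) - d₀) * ((d₁ : ℝ) + d₃ - d₀ - d₂) * ((d₃ : ℝ) - d₀) := ⟨_, rfl⟩
  obtain ⟨PC, hPC⟩ : ∃ x : ℝ, x = ((d₁ : ℝ) - e) * ((d₁ : ℝ) - d₀) * ((d₃ : ℝ) - d₁) * ((d₀ : ℝ) + d₃ - e - d₁) * ((d₂ : ℝ) - e) * ((d₃ : ℝ) - e) * ((d₂ : ℝ) + d₃ - e - d₁) := ⟨_, rfl⟩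
  obtain ⟨PD, hPD⟩ : ∃ x : ℝ, x = ((d₂ : ℝ) - e) * ((d₂ : ℝ) - d₀) * ((d₃ : ℝ) - d₂) * ((e : ℝ) + d₂ - d₀ - d₃) * ((d₁ : ℝ) - e) * ((d₁ : ℝ) + d₃ - e - d₂) * ((d₃ : ℝ) - e) := ⟨_, rfl⟩
  have hS' : D02 * (-m₁) * PB * PC ≤ D01 * (-m₂) * PA * PD := by rw [hPA, hPB, hPC, hPD]; exact hS
  clear hS
  have hPBp : 0 < PB := by
    rw [hPB]
    have f1 : 0 < ((d₀ : ℝ) + d₂ - 2 * e) := by linarith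
    have f2 : 0 < ((d₂ : ℝ) - e) := by linarith
    have f3 : 0 < ((e : ℝ) + d₃ - d₀ - d₂) := by linarith
    have f4 : 0 < ((d₃ : ℝ) - d₂) := by linarith
    have f5 : 0 < ((d₁ : ℝ) - d₀) := by linarith
    have f6 : 0 < ((d₁ : ℝ) + d₃ - d₀ - d₂) := by linarith
    have f7 : 0 < ((d₃ : ℝ) - d₀) := by linarith
    exact mul_pos (mul_pos (mul_pos (mul_pos (mul_pos (mul_pos f1 f2) f3) f4) f5) f6) f7
  have hPDp : 0 < PD := by
    rw [hPD]
    have f1 : 0 < ((d₂ : ℝ) - e) := by linarith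
    have f2 : 0 < ((d₂ : ℝ) - d₀) := by linarith
    have f3 : 0 < ((d₃ : ℝ) - d₂) := by linarith
    have f4 : 0 < ((e : ℝ) + d₂ - d₀ - d₃) := by linarith
    have f5 : 0 < ((d₁ : ℝ) - e) := by linarith
    have f6 : 0 < ((d₁ : ℝ) + d₃ - e - d₂) := by linarith
    have f7 : 0 < ((d₃ : ℝ) - e) := by linarith
    exact mul_pos (mul_pos (mul_pos (mul_pos (mul_pos (mul_pos f1 f2) f3) f4) f5) f6) f7
  -- the four surviving coefficients
  obtain ⟨A, hA⟩ : ∃ x : ℝ, x = w₀ * w₁ * D01 * PA := ⟨_, rfl⟩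
  obtain ⟨B, hB⟩ : ∃ x : ℝ, x = w₀ * w₂ * D02 * PB := ⟨_, rfl⟩
  obtain ⟨C, hC⟩ : ∃ x : ℝ, x = w₁ * (-m₁) * PC := ⟨_, rfl⟩
  obtain ⟨D, hD⟩ : ∃ x : ℝ, x = w₂ * (-m₂) * PD := ⟨_, rfl⟩
  have hBp : 0 < B := by rw [hB]; exact mul_pos (mul_pos (mul_pos hw₀ hw₂) hD02) hPBp
  have hDp : 0 < D := by rw [hD]; exact mul_pos (mul_pos hw₂ (by linarith)) hPDp
  have hBC : B * C ≤ A * D := by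
    have e1 : B * C = (w₀ * w₁ * w₂) * (D02 * (-m₁) * PB * PC) := by rw [hB, hC]; ring
    have e2 : A * D = (w₀ * w₁ * w₂) * (D01 * (-m₂) * PA * PD) := by rw [hA, hD]; ring
    rw [e1, e2]
    exact mul_le_mul_of_nonneg_left hS' (mul_pos (mul_pos hw₀ hw₁) hw₂).le
  -- seven kills
  have hkills := card_posRoots_le_kills (Finset.univ : Finset (Fin 11)) (![2 * e, e + d₀, e + d₁, e + d₂, e + d₃, d₀ + d₁, d₀ + d₂, d₀ + d₃, d₁ + d₂, d₁ + d₃, d₂ + d₃] : Fin 11 → ℕ) [2 * e, e + d₀, e + d₃, d₀ + d₃, d₁ + d₂, d₁ + d₃, d₂ + d₃] (![dJ, w₀ * m₀, w₁ * m₁, w₂ * m₂, w₃ * m₃, w₀ * w₁ * D01, w₀ * w₂ * D02, w₀ * w₃ * D03, w₁ * w₂ * D12, w₁ * w₃ * D13, w₂ * w₃ * D23] : Fin 11 → ℝ)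
  have hfour : (∑ i ∈ (Finset.univ : Finset (Fin 11)), Polynomial.C ((![dJ, w₀ * m₀, w₁ * m₁, w₂ * m₂, w₃ * m₃, w₀ * w₁ * D01, w₀ * w₂ * D02, w₀ * w₃ * D03, w₁ * w₂ * D12, w₁ * w₃ * D13, w₂ * w₃ * D23] : Fin 11 → ℝ) i
          * (([2 * e, e + d₀, e + d₃, d₀ + d₃, d₁ + d₂, d₁ + d₃, d₂ + d₃]).map (fun ρ : ℕ => (((((![2 * e, e + d₀, e + d₁, e + d₂, e + d₃, d₀ + d₁, d₀ + d₂, d₀ + d₃, d₁ + d₂, d₁ + d₃, d₂ + d₃] : Fin 11 → ℕ)) i : ℕ) : ℝ) - (ρ : ℝ)))).prod) * X ^ ((![2 * e, e + d₀, e + d₁, e + d₂, e + d₃, d₀ + d₁, d₀ + d₂, d₀ + d₃, d₁ + d₂, d₁ + d₃, d₂ + d₃] : Fin 11 → ℕ) i))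
      = (Polynomial.C A * X ^ (d₀ + d₁) - Polynomial.C B * X ^ (d₀ + d₁ + (d₂ - d₁))
          + Polynomial.C C * X ^ (d₀ + d₁ + (e - d₀)) - Polynomial.C D * X ^ (d₀ + d₁ + (d₂ - d₁) + (e - d₀))) := by
    have e3 : d₀ + d₁ + (d₂ - d₁) + (e - d₀) = e + d₂ := by omega
    have e1 : d₀ + d₁ + (d₂ - d₁) = d₀ + d₂ := by omega
    have e2 : d₀ + d₁ + (e - d₀) = e + d₁ := by omega
    rw [e3, e1, e2]
    have hcoef : ∀ i : Fin 11, (![dJ, w₀ * m₀, w₁ * m₁, w₂ * m₂, w₃ * m₃, w₀ * w₁ * D01, w₀ * w₂ * D02, w₀ * w₃ * D03, w₁ * w₂ * D12, w₁ * w₃ * D13, w₂ * w₃ * D23] : Fin 11 → ℝ) i * (([2 * e, e + d₀, e + d₃, d₀ + d₃, d₁ + d₂, d₁ + d₃, d₂ + d₃]).map (fun ρ : ℕ => (((((![2 * e, e + d₀, e + d₁, e + d₂, e + d₃, d₀ + d₁, d₀ + d₂, d₀ + d₃, d₁ + d₂, d₁ + d₃, d₂ + d₃] : Fin 11 → ℕ))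 i : ℕ) : ℝ) - (ρ : ℝ)))).prod
        = (![0, 0, C, -D, 0, A, -B, 0, 0, 0, 0] : Fin 11 → ℝ) i := by
      intro i
      fin_cases i <;>
        simp only [Fin.zero_eta, Fin.mk_one, Fin.isValue, Matrix.cons_val_zero, Matrix.cons_val_one,
          List.map_cons, List.map_nil, List.prod_cons, List.prod_nil, hA, hB, hC, hD, hPA, hPB, hPC, hPD] <;>
        push_cast <;> ring
    rw [Finset.sum_congr rfl (fun i _ => by rw [hcoef i])]
    simp only [Fin.sum_univ_succ, Fin.sum_univ_zero, Matrix.cons_val_zero, Matrix.cons_val_succ, map_zero, zero_mul,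
      zero_add, add_zero, Polynomial.C_neg]
    ring
  rw [hfour] at hkills
  have hone := card_posRoots_fourNomial_le_one A B C D hBp hDp hBC (d₀ + d₁) (d₂ - d₁) (e - d₀) (by omega)
  simp only [List.length_cons, List.length_nil] at hkills
  omega

/-- **`Z₊ ≤ 8` under (S₀₁₂)** (matrix form). [this file] -/
theorem oneThree_rankOne_posRoots_le_eight_of_S012 (e d₀ d₁ d₂ d₃ : ℕ) (h0e : d₀ < e) (he1 : e < d₁) (h12 : d₁ < d₂) (h23 : d₂ < d₃)
    (hC2 : 2 * e < d₀ + d₂) (hC5 : d₀ + d₃ < e + d₂)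
    (J : Matrix (Fin 2) (Fin 2) ℝ) (v₀ v₁ v₂ v₃ : Fin 2 → ℝ) (w₀ w₁ w₂ w₃ : ℝ) (hw₀ : 0 < w₀) (hw₁ : 0 < w₁) (hw₂ : 0 < w₂) (hm₂ : (J 0 0 * v₂ 1 ^ 2 + J 1 1 * v₂ 0 ^ 2 - (J 0 1 + J 1 0) * (v₂ 0 * v₂ 1)) < 0)
    (hv02 : v₀ 0 * v₂ 1 - v₀ 1 * v₂ 0 ≠ 0)
    (hS : ((v₀ 0 * v₂ 1 - v₀ 1 * v₂ 0) ^ 2) * (-(J 0 0 * v₁ 1 ^ 2 + J 1 1 * v₁ 0 ^ 2 - (J 0 1 + J 1 0) * (v₁ 0 * v₁ 1)))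
        * (((d₀ : ℝ) + d₂ - 2 * e) * ((d₂ : ℝ) - e) * ((e : ℝ) + d₃ - d₀ - d₂) * ((d₃ : ℝ) - d₂) * ((d₁ : ℝ) - d₀) * ((d₁ : ℝ) + d₃ - d₀ - d₂) * ((d₃ : ℝ) - d₀))
        * (((d₁ : ℝ) - e) * ((d₁ : ℝ) - d₀) * ((d₃ : ℝ) - d₁) * ((d₀ : ℝ) + d₃ - e - d₁) * ((d₂ : ℝ) - e) * ((d₃ : ℝ) - e) * ((d₂ : ℝ) + d₃ - e - d₁))
        ≤ ((v₀ 0 * v₁ 1 - v₀ 1 * v₁ 0) ^ 2) * (-(J 0 0 * v₂ 1 ^ 2 + J 1 1 * v₂ 0 ^ 2 - (J 0 1 + J 1 0) * (v₂ 0 * v₂ 1)))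
        * (((2 : ℝ) * e - d₀ - d₁) * ((d₁ : ℝ) - e) * ((e : ℝ) + d₃ - d₀ - d₁) * ((d₃ : ℝ) - d₁) * ((d₂ : ℝ) - d₀) * ((d₃ : ℝ) - d₀) * ((d₂ : ℝ) + d₃ - d₀ - d₁))
        * (((d₂ : ℝ) - e) * ((d₂ : ℝ) - d₀) * ((d₃ : ℝ) - d₂) * ((e : ℝ) + d₂ - d₀ - d₃) * ((d₁ : ℝ) - e) * ((d₁ : ℝ) + d₃ - e - d₂) * ((d₃ : ℝ) - e))) :
    ((Matrix.det (((X : ℝ[X]) ^ e) • J.map Polynomial.C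
        + (Polynomial.C w₀ * X ^ d₀) • (vecMulVec v₀ v₀).map Polynomial.C
        + (Polynomial.C w₁ * X ^ d₁) • (vecMulVec v₁ v₁).map Polynomial.C
        + (Polynomial.C w₂ * X ^ d₂) • (vecMulVec v₂ v₂).map Polynomial.C
        + (Polynomial.C w₃ * X ^ d₃) • (vecMulVec v₃ v₃).map Polynomial.C)).roots.toFinset.filter (fun t => 0 < t)).card
      ≤ 8 := by
  rw [det_rankOne_four_sum]
  exact elevenNomial_oneThree_S012_le_eight e d₀ d₁ d₂ d₃ h0e he1 h12 h23 hC2 hC5 J.det _ _ _ _ w₀ w₁ w₂ w₃ _ _ _ _ _ _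
    hw₀ hw₁ hw₂ hm₂ (by positivity) hS

/-! ## 2. (S₀₁₃) -/

/-- **(S₀₁₃), real-parameter form** (split `d₀ < e < d₁ < d₂ < d₃`, `d₀+d₂ < e+d₁`, `d₁+d₂ < e+d₃`; `m₁, m₃ < 0`, `w₀,w₁,w₃ > 0`, the rest arbitrary). -/
theorem elevenNomial_oneThree_S013_le_eight (e d₀ d₁ d₂ d₃ : ℕ) (h0e : d₀ < e) (he1 : e < d₁) (h12 : d₁ < d₂) (h23 : d₂ < d₃)
    (hC3 : d₀ + d₂ < e + d₁) (hC6 : d₁ + d₂ < e + d₃)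
    (dJ m₀ m₁ m₂ m₃ w₀ w₁ w₂ w₃ D01 D02 D03 D12 D13 D23 : ℝ) (hw₀ : 0 < w₀) (hw₁ : 0 < w₁) (hw₃ : 0 < w₃) (hm₁ : m₁ < 0) (hm₃ : m₃ < 0)
    (hS : (-m₁) * D03
        * (((d₁ : ℝ) - e) * ((d₁ : ℝ) - d₀) * ((d₂ : ℝ) - d₁) * ((e : ℝ) + d₁ - d₀ - d₂) * ((d₂ : ℝ) - e) * ((d₃ : ℝ) - e) * ((d₂ : ℝ) + d₃ - e - d₁))
        * (((d₀ : ℝ) + d₃ - 2 * e) * ((d₃ : ℝ) - e) * ((e : ℝ) + d₂ - d₀ - d₃) * ((d₃ : ℝ) - d₂) * ((d₁ : ℝ) + d₂ - d₀ - d₃) * ((d₁ : ℝ) - d₀) * ((d₂ : ℝ) - d₀))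
        ≤ (-m₃) * D01
        * (((2 : ℝ) * e - d₀ - d₁) * ((d₁ : ℝ) - e) * ((e : ℝ) + d₂ - d₀ - d₁) * ((d₂ : ℝ) - d₁) * ((d₂ : ℝ) - d₀) * ((d₃ : ℝ) - d₀) * ((d₂ : ℝ) + d₃ - d₀ - d₁))
        * (((d₃ : ℝ) - e) * ((d₃ : ℝ) - d₀) * ((d₃ : ℝ) - d₂) * ((e : ℝ) + d₃ - d₀ - d₂) * ((e : ℝ) + d₃ - d₁ - d₂) * ((d₁ : ℝ) - e) * ((d₂ : ℝ) - e))) :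
    ((∑ i : Fin 11, Polynomial.C ((![dJ, w₀ * m₀, w₁ * m₁, w₂ * m₂, w₃ * m₃, w₀ * w₁ * D01, w₀ * w₂ * D02, w₀ * w₃ * D03, w₁ * w₂ * D12, w₁ * w₃ * D13, w₂ * w₃ * D23] : Fin 11 → ℝ) i) * X ^ ((![2 * e, e + d₀, e + d₁, e + d₂, e + d₃, d₀ + d₁, d₀ + d₂, d₀ + d₃, d₁ + d₂, d₁ + d₃, d₂ + d₃] : Fin 11 → ℕ) i)).roots.toFinset.filter (fun t => 0 < t)).card ≤ 8 := by
  classical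
  have h0e' : (d₀ : ℝ) < e := by exact_mod_cast h0e
  have he1' : (e : ℝ) < d₁ := by exact_mod_cast he1
  have h12' : (d₁ : ℝ) < d₂ := by exact_mod_cast h12
  have h23' : (d₂ : ℝ) < d₃ := by exact_mod_cast h23
  have hC3' : (d₀ : ℝ) + d₂ < e + d₁ := by exact_mod_cast hC3
  have hC6' : (d₁ : ℝ) + d₂ < e + d₃ := by exact_mod_cast hC6
  -- the four distance products (positive atoms)
  obtain ⟨PA, hPA⟩ : ∃ x : ℝ, x = ((2 : ℝ) * e - d₀ - d₁) * ((d₁ : ℝ) - e) * ((e : ℝ) + d₂ - d₀ - d₁) * ((d₂ : ℝ) - d₁) * ((d₂ : ℝ) - d₀) * ((d₃ : ℝ) - d₀) * ((d₂ : ℝ) + d₃ - d₀ - d₁) := ⟨_, rfl⟩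
  obtain ⟨PB, hPB⟩ : ∃ x : ℝ, x = ((d₁ : ℝ) - e) * ((d₁ : ℝ) - d₀) * ((d₂ : ℝ) - d₁) * ((e : ℝ) + d₁ - d₀ - d₂) * ((d₂ : ℝ) - e) * ((d₃ : ℝ) - e) * ((d₂ : ℝ) + d₃ - e - d₁) := ⟨_, rfl⟩
  obtain ⟨PC, hPC⟩ : ∃ x : ℝ, x = ((d₀ : ℝ) + d₃ - 2 * e) * ((d₃ : ℝ) - e) * ((e : ℝ) + d₂ - d₀ - d₃) * ((d₃ : ℝ) - d₂) * ((d₁ : ℝ) + d₂ - d₀ - d₃) * ((d₁ : ℝ) - d₀) * ((d₂ : ℝ) - d₀) := ⟨_, rfl⟩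
  obtain ⟨PD, hPD⟩ : ∃ x : ℝ, x = ((d₃ : ℝ) - e) * ((d₃ : ℝ) - d₀) * ((d₃ : ℝ) - d₂) * ((e : ℝ) + d₃ - d₀ - d₂) * ((e : ℝ) + d₃ - d₁ - d₂) * ((d₁ : ℝ) - e) * ((d₂ : ℝ) - e) := ⟨_, rfl⟩
  have hS' : (-m₁) * D03 * PB * PC ≤ (-m₃) * D01 * PA * PD := by rw [hPA, hPB, hPC, hPD]; exact hS
  clear hS
  have hPBp : 0 < PB := by
    rw [hPB]
    have f1 : 0 < ((d₁ : ℝ) - e) := by linarith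
    have f2 : 0 < ((d₁ : ℝ) - d₀) := by linarith
    have f3 : 0 < ((d₂ : ℝ) - d₁) := by linarith
    have f4 : 0 < ((e : ℝ) + d₁ - d₀ - d₂) := by linarith
    have f5 : 0 < ((d₂ : ℝ) - e) := by linarith
    have f6 : 0 < ((d₃ : ℝ) - e) := by linarith
    have f7 : 0 < ((d₂ : ℝ) + d₃ - e - d₁) := by linarith
    exact mul_pos (mul_pos (mul_pos (mul_pos (mul_pos (mul_pos f1 f2) f3) f4) f5) f6) f7
  have hPDp : 0 < PD := by
    rw [hPD]
    have f1 : 0 < ((d₃ : ℝ) - e) := by linarith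
    have f2 : 0 < ((d₃ : ℝ) - d₀) := by linarith
    have f3 : 0 < ((d₃ : ℝ) - d₂) := by linarith
    have f4 : 0 < ((e : ℝ) + d₃ - d₀ - d₂) := by linarith
    have f5 : 0 < ((e : ℝ) + d₃ - d₁ - d₂) := by linarith
    have f6 : 0 < ((d₁ : ℝ) - e) := by linarith
    have f7 : 0 < ((d₂ : ℝ) - e) := by linarith
    exact mul_pos (mul_pos (mul_pos (mul_pos (mul_pos (mul_pos f1 f2) f3) f4) f5) f6) f7
  -- the four surviving coefficients
  obtain ⟨A, hA⟩ : ∃ x : ℝ, x = w₀ * w₁ * D01 * PA := ⟨_, rfl⟩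
  obtain ⟨B, hB⟩ : ∃ x : ℝ, x = w₁ * (-m₁) * PB := ⟨_, rfl⟩
  obtain ⟨C, hC⟩ : ∃ x : ℝ, x = w₀ * w₃ * D03 * PC := ⟨_, rfl⟩
  obtain ⟨D, hD⟩ : ∃ x : ℝ, x = w₃ * (-m₃) * PD := ⟨_, rfl⟩
  have hBp : 0 < B := by rw [hB]; exact mul_pos (mul_pos hw₁ (by linarith)) hPBp
  have hDp : 0 < D := by rw [hD]; exact mul_pos (mul_pos hw₃ (by linarith)) hPDp
  have hBC : B * C ≤ A * D := by
    have e1 : B * C = (w₀ * w₁ * w₃) * ((-m₁) * D03 * PB * PC) := by rw [hB, hC]; ring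
    have e2 : A * D = (w₀ * w₁ * w₃) * ((-m₃) * D01 * PA * PD) := by rw [hA, hD]; ring
    rw [e1, e2]
    exact mul_le_mul_of_nonneg_left hS' (mul_pos (mul_pos hw₀ hw₁) hw₃).le
  -- seven kills
  have hkills := card_posRoots_le_kills (Finset.univ : Finset (Fin 11)) (![2 * e, e + d₀, e + d₁, e + d₂, e + d₃, d₀ + d₁, d₀ + d₂, d₀ + d₃, d₁ + d₂, d₁ + d₃, d₂ + d₃] : Fin 11 → ℕ) [2 * e, e + d₀, e + d₂, d₀ + d₂, d₁ + d₂, d₁ + d₃, d₂ + d₃] (![dJ, w₀ * m₀, w₁ * m₁, w₂ * m₂, w₃ * m₃, w₀ * w₁ * D01, w₀ * w₂ * D02, w₀ * w₃ * D03, w₁ * w₂ * D12, w₁ * w₃ * D13, w₂ * w₃ * D23] : Fin 11 → ℝ)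
  have hfour : (∑ i ∈ (Finset.univ : Finset (Fin 11)), Polynomial.C ((![dJ, w₀ * m₀, w₁ * m₁, w₂ * m₂, w₃ * m₃, w₀ * w₁ * D01, w₀ * w₂ * D02, w₀ * w₃ * D03, w₁ * w₂ * D12, w₁ * w₃ * D13, w₂ * w₃ * D23] : Fin 11 → ℝ) i
          * (([2 * e, e + d₀, e + d₂, d₀ + d₂, d₁ + d₂, d₁ + d₃, d₂ + d₃]).map (fun ρ : ℕ => (((((![2 * e, e + d₀, e + d₁, e + d₂, e + d₃, d₀ + d₁, d₀ + d₂, d₀ + d₃, d₁ + d₂, d₁ + d₃, d₂ + d₃] : Fin 11 → ℕ)) i : ℕ) : ℝ) - (ρ : ℝ)))).prod) * X ^ ((![2 * e, e + d₀, e + d₁, e + d₂, e + d₃, d₀ + d₁, d₀ + d₂, d₀ + d₃, d₁ + d₂, d₁ + d₃, d₂ + d₃] : Fin 11 → ℕ) i))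
      = (Polynomial.C A * X ^ (d₀ + d₁) - Polynomial.C B * X ^ (d₀ + d₁ + (e - d₀))
          + Polynomial.C C * X ^ (d₀ + d₁ + (d₃ - d₁)) - Polynomial.C D * X ^ (d₀ + d₁ + (e - d₀) + (d₃ - d₁))) := by
    have e3 : d₀ + d₁ + (e - d₀) + (d₃ - d₁) = e + d₃ := by omega
    have e1 : d₀ + d₁ + (e - d₀) = e + d₁ := by omega
    have e2 : d₀ + d₁ + (d₃ - d₁) = d₀ + d₃ := by omega
    rw [e3, e1, e2]
    have hcoef : ∀ i : Fin 11, (![dJ, w₀ * m₀, w₁ * m₁, w₂ * m₂, w₃ * m₃, w₀ * w₁ * D01, w₀ * w₂ * D02, w₀ * w₃ * D03, w₁ * w₂ * D12, w₁ * w₃ * D13, w₂ * w₃ * D23] : Fin 11 → ℝ) i * (([2 * e, e + d₀, e + d₂, d₀ + d₂, d₁ + d₂, d₁ + d₃, d₂ + d₃]).map (fun ρ : ℕ => (((((![2 * e, e + d₀, e + d₁, e + d₂, e + d₃, d₀ + d₁, d₀ + d₂, d₀ + d₃, d₁ + d₂, d₁ + d₃, d₂ + d₃] : Fin 11 → ℕ))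 i : ℕ) : ℝ) - (ρ : ℝ)))).prod
        = (![0, 0, -B, 0, -D, A, 0, C, 0, 0, 0] : Fin 11 → ℝ) i := by
      intro i
      fin_cases i <;>
        simp only [Fin.zero_eta, Fin.mk_one, Fin.isValue, Matrix.cons_val_zero, Matrix.cons_val_one,
          List.map_cons, List.map_nil, List.prod_cons, List.prod_nil, hA, hB, hC, hD, hPA, hPB, hPC, hPD] <;>
        push_cast <;> ring
    rw [Finset.sum_congr rfl (fun i _ => by rw [hcoef i])]
    simp only [Fin.sum_univ_succ, Fin.sum_univ_zero, Matrix.cons_val_zero, Matrix.cons_val_succ, map_zero, zero_mul,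
      zero_add, add_zero, Polynomial.C_neg]
    ring
  rw [hfour] at hkills
  have hone := card_posRoots_fourNomial_le_one A B C D hBp hDp hBC (d₀ + d₁) (e - d₀) (d₃ - d₁) (by omega)
  simp only [List.length_cons, List.length_nil] at hkills
  omega

/-- **`Z₊ ≤ 8` under (S₀₁₃)** (matrix form). [this file] -/
theorem oneThree_rankOne_posRoots_le_eight_of_S013 (e d₀ d₁ d₂ d₃ : ℕ) (h0e : d₀ < e) (he1 : e < d₁) (h12 : d₁ < d₂) (h23 : d₂ < d₃)
    (hC3 : d₀ + d₂ < e + d₁) (hC6 : d₁ + d₂ < e + d₃)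
    (J : Matrix (Fin 2) (Fin 2) ℝ) (v₀ v₁ v₂ v₃ : Fin 2 → ℝ) (w₀ w₁ w₂ w₃ : ℝ) (hw₀ : 0 < w₀) (hw₁ : 0 < w₁) (hw₃ : 0 < w₃) (hm₁ : (J 0 0 * v₁ 1 ^ 2 + J 1 1 * v₁ 0 ^ 2 - (J 0 1 + J 1 0) * (v₁ 0 * v₁ 1)) < 0)
    (hm₃ : (J 0 0 * v₃ 1 ^ 2 + J 1 1 * v₃ 0 ^ 2 - (J 0 1 + J 1 0) * (v₃ 0 * v₃ 1)) < 0)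
    (hS : (-(J 0 0 * v₁ 1 ^ 2 + J 1 1 * v₁ 0 ^ 2 - (J 0 1 + J 1 0) * (v₁ 0 * v₁ 1))) * ((v₀ 0 * v₃ 1 - v₀ 1 * v₃ 0) ^ 2)
        * (((d₁ : ℝ) - e) * ((d₁ : ℝ) - d₀) * ((d₂ : ℝ) - d₁) * ((e : ℝ) + d₁ - d₀ - d₂) * ((d₂ : ℝ) - e) * ((d₃ : ℝ) - e) * ((d₂ : ℝ) + d₃ - e - d₁))
        * (((d₀ : ℝ) + d₃ - 2 * e) * ((d₃ : ℝ) - e) * ((e : ℝ) + d₂ - d₀ - d₃) * ((d₃ : ℝ) - d₂) * ((d₁ : ℝ) + d₂ - d₀ - d₃) * ((d₁ : ℝ) - d₀) * ((d₂ : ℝ) - d₀))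
        ≤ (-(J 0 0 * v₃ 1 ^ 2 + J 1 1 * v₃ 0 ^ 2 - (J 0 1 + J 1 0) * (v₃ 0 * v₃ 1))) * ((v₀ 0 * v₁ 1 - v₀ 1 * v₁ 0) ^ 2)
        * (((2 : ℝ) * e - d₀ - d₁) * ((d₁ : ℝ) - e) * ((e : ℝ) + d₂ - d₀ - d₁) * ((d₂ : ℝ) - d₁) * ((d₂ : ℝ) - d₀) * ((d₃ : ℝ) - d₀) * ((d₂ : ℝ) + d₃ - d₀ - d₁))
        * (((d₃ : ℝ) - e) * ((d₃ : ℝ) - d₀) * ((d₃ : ℝ) - d₂) * ((e : ℝ) + d₃ - d₀ - d₂) * ((e : ℝ) + d₃ - d₁ - d₂) * ((d₁ : ℝ) - e) * ((d₂ : ℝ) - e))) :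
    ((Matrix.det (((X : ℝ[X]) ^ e) • J.map Polynomial.C
        + (Polynomial.C w₀ * X ^ d₀) • (vecMulVec v₀ v₀).map Polynomial.C
        + (Polynomial.C w₁ * X ^ d₁) • (vecMulVec v₁ v₁).map Polynomial.C
        + (Polynomial.C w₂ * X ^ d₂) • (vecMulVec v₂ v₂).map Polynomial.C
        + (Polynomial.C w₃ * X ^ d₃) • (vecMulVec v₃ v₃).map Polynomial.C)).roots.toFinset.filter (fun t => 0 < t)).card
      ≤ 8 := by
  rw [det_rankOne_four_sum]
  exact elevenNomial_oneThree_S013_le_eight e d₀ d₁ d₂ d₃ h0e he1 h12 h23 hC3 hC6 J.det _ _ _ _ w₀ w₁ w₂ w₃ _ _ _ _ _ _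
    hw₀ hw₁ hw₃ hm₁ hm₃ hS

end Summit.ValiantsHypothesis.ValiantsHypothesis.Theorems.LacunarySymmetroidMatrixDescartes.Pivot.TwoDirections.BlockLaw
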